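import Summits.Langlands.Langlands.Theorems.PhantomRMYoshidaResiduallyYoshidaLiftingNonsplitInvariantSubspaces
import Summits.Langlands.Langlands.Theorems.PhantomRMYoshidaResiduallyYoshidaLiftingNonsplitCommutant
import HarnessLib

/-!
# No stable line for a realiser of a non-trivial residual class (stub `stub_noStableLine`, T2) — line `sector-klingen-split`

Stub-worker of lead prover-line-stmt-Langlands-13639-c4-0 (crux `ResiduallyYoshidaLifting`, stmt-Langlands-13639,
skeleton rev 7, sub-goal T2 of "every symplectic realiser of a non-trivial class is irreducible": the Klingen/Borel-type
case of the reducible locus of the realisation fibre).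

**Theorem (`stub_noStableLine`).**  Let `σ, σ' : Γ → GL₂(k)` be irreducible, `B : Γ → M₂(k)` NOT a coboundary
`σ X - X σ'`, `red : ℤ̄_p → k` a ring map (`ℤ̄_p = 𝒪[ℚ̄_p] = Valued.integer (PadicAlgCl p)`), and
`rint : Γ → GL₄(ℤ̄_p)` an integral frame whose reduction through `red` is `h (σ, B; 0, σ') h⁻¹` (blocks along
`finSumFinEquiv`).  Then no line of `ℚ̄_p⁴` is stable under all `rint g`: there is no `v ≠ 0` with `rint g • v = c_g v`
for all `g`.

**Proof.**  (1) Primitive rescaling (`exists_integral_eigenvector`): divide `v` by a coordinate `q = v i` of maximal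
norm; `w = q⁻¹ v` is integral with `w i = 1` and is still a common eigenvector; comparing `i`-th coordinates,
`c_g = (rint g • w) i ∈ ℤ̄_p`, so `rint g • w = c_g w` over `ℤ̄_p` (injectivity of `ℤ̄_p ⊆ ℚ̄_p`).  (2) Reduce: `x = red ∘ w`
has `x i = 1`, so `x ≠ 0`, and `red(rint g) • x = red(c_g) x`; with the reduction identity, `u = h⁻¹ x` (in block
coordinates) spans a line of `k² ⊕ k²` stable under every `(σ g, B g; 0, σ' g)` (`not_exists_eigenvector_residual`).
(3) By the invariant-subspace trichotomy (`Ribet.stub_nonsplitInvariantSubspaces`, p152467) that line is `⊥` — impossible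
as `u ≠ 0` — or it is `⊤` or the `σ`-plane `k² ⊕ 0`; in the last two cases `(e₀, 0)` and `(e₁, 0)` are both multiples
of `u`, which is absurd (`not_exists_eigenvector_fromBlocks`).
-/

noncomputable section

open scoped MatrixGroups Matrix

set_option linter.dupNamespace false
set_option autoImplicit false

namespace Summit.Langlands.Langlands.Cruxes.ResiduallyYoshidaLifting.SectorKlingenSplit.Fibre

open Literature.NumberTheory.GaloisRepresentations
open Summit.Langlands.Langlands.Cruxes.ResiduallyYoshidaLifting.EndoscopicCrossingEuler

/-! ### Residual step: a non-split `(σ, B; 0, σ')` has no common eigenvector -/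

section Residual

variable {k : Type} [Field k] {Γ : Type} [Group Γ]

/-- A non-split block upper-triangular `(σ, B; 0, σ')` with irreducible `2`-dimensional diagonal blocks has no
common eigenvector: its stable subspaces are `⊥`, the `σ`-plane and `⊤` (trichotomy `Ribet.stub_nonsplitInvariantSubspaces`),
and none of them is a line. [folklore] -/
theorem not_exists_eigenvector_fromBlocks (σ σ' : Γ →* GL (Fin 2) k)
    (hσ : Representation.IsIrreducible ((glStdRepresentation (Fin 2) k).comp σ))
    (hσ' : Representation.IsIrreducible ((glStdRepresentation (Fin 2) k).comp σ'))
    (B : Γ → Matrix (Fin 2) (Fin 2) k)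
    (hB : ¬ ∃ X : Matrix (Fin 2) (Fin 2) k, ∀ g, B g = (σ g).val * X - X * (σ' g).val)
    (u : Fin 2 ⊕ Fin 2 → k) (hu : u ≠ 0)
    (hstab : ∀ g, ∃ d : k, Matrix.fromBlocks (σ g).val (B g) 0 (σ' g).val *ᵥ u = d • u) : False := by
  set W : Submodule k (Fin 2 ⊕ Fin 2 → k) := k ∙ u with hWdef
  have huW : u ∈ W := Submodule.mem_span_singleton_self u
  have hW : ∀ g, ∀ w ∈ W, (Matrix.fromBlocks (σ g).val (B g) 0 (σ' g).val).mulVec w ∈ W := by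
    intro g w hw
    obtain ⟨a, rfl⟩ := Submodule.mem_span_singleton.mp hw
    obtain ⟨d, hd⟩ := hstab g
    rw [Matrix.mulVec_smul, hd, smul_smul]
    exact Submodule.smul_mem _ _ huW
  -- the two basis vectors `(e₀, 0)`, `(e₁, 0)` of the `σ`-plane are not both multiples of `u`
  have hplane : ¬ ((Sum.elim ![1, 0] 0 : Fin 2 ⊕ Fin 2 → k) ∈ W ∧
      (Sum.elim ![0, 1] 0 : Fin 2 ⊕ Fin 2 → k) ∈ W) := by
    rintro ⟨h0, h1⟩
    obtain ⟨a, ha⟩ := Submodule.mem_span_singleton.mp h0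
    obtain ⟨b, hb⟩ := Submodule.mem_span_singleton.mp h1
    have ha0 := congrFun ha (Sum.inl 0)
    have hb0 := congrFun hb (Sum.inl 0)
    have hb1 := congrFun hb (Sum.inl 1)
    simp only [Pi.smul_apply, smul_eq_mul, Sum.elim_inl, Matrix.cons_val_zero, Matrix.cons_val_one] at ha0 hb0 hb1
    have hu0 : u (Sum.inl 0) ≠ 0 := fun h => by
      rw [h, mul_zero] at ha0
      exact zero_ne_one ha0
    have hb' : b = 0 := (mul_eq_zero.mp hb0).resolve_right hu0
    rw [hb', zero_mul] at hb1
    exact zero_ne_one hb1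
  rcases Ribet.stub_nonsplitInvariantSubspaces k Γ σ σ' hσ hσ' B hB W hW with hbot | htop | hpl
  · rw [hbot, Submodule.mem_bot] at huW
    exact hu huW
  · refine hplane ⟨?_, ?_⟩ <;> rw [htop] <;> exact Submodule.mem_top
  · exact hplane ⟨(hpl _).mpr fun _ => rfl, (hpl _).mpr fun _ => rfl⟩

/-- The realised residual representation `h (σ, B; 0, σ') h⁻¹` on `k⁴` (blocks along `finSumFinEquiv`, `B` not a
coboundary, `σ, σ'` irreducible) has no common eigenvector. [folklore] -/
theorem not_exists_eigenvector_residual (σ σ' : Γ →* GL (Fin 2) k)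
    (hσ : Representation.IsIrreducible ((glStdRepresentation (Fin 2) k).comp σ))
    (hσ' : Representation.IsIrreducible ((glStdRepresentation (Fin 2) k).comp σ'))
    (B : Γ → Matrix (Fin 2) (Fin 2) k)
    (hB : ¬ ∃ X : Matrix (Fin 2) (Fin 2) k, ∀ g, B g = (σ g).val * X - X * (σ' g).val)
    (h : GL (Fin 4) k) (x : Fin 4 → k) (hx : x ≠ 0)
    (hstab : ∀ g, ∃ d : k, (h.val * Matrix.reindex finSumFinEquiv finSumFinEquiv
        (Matrix.fromBlocks (σ g).val (B g) 0 (σ' g).val) * (h⁻¹).val) *ᵥ x = d • x) : False := by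
  set y : Fin 4 → k := (h⁻¹).val *ᵥ x with hydef
  have hxy : h.val *ᵥ y = x := by
    rw [hydef, Matrix.mulVec_mulVec, Units.mul_inv, Matrix.one_mulVec]
  have hy : y ≠ 0 := fun h0 => hx (by rw [← hxy, h0, Matrix.mulVec_zero])
  set u : Fin 2 ⊕ Fin 2 → k := y ∘ ⇑(finSumFinEquiv : Fin 2 ⊕ Fin 2 ≃ Fin (2 + 2)) with hudef
  have hu : u ≠ 0 := by
    intro h0
    apply hy
    funext a
    have e := congrFun h0 ((finSumFinEquiv : Fin 2 ⊕ Fin 2 ≃ Fin (2 + 2)).symm a)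
    rw [hudef, Function.comp_apply, Equiv.apply_symm_apply] at e
    exact e
  refine not_exists_eigenvector_fromBlocks σ σ' hσ hσ' B hB u hu fun g => ?_
  obtain ⟨d, hd⟩ := hstab g
  refine ⟨d, ?_⟩
  -- `F y = d y` for the reindexed block matrix `F`
  have h1 : Matrix.reindex finSumFinEquiv finSumFinEquiv (Matrix.fromBlocks (σ g).val (B g) 0 (σ' g).val) *ᵥ y =
      d • y := by
    have e1 := congrArg (fun z : Fin 4 → k => (h⁻¹).val *ᵥ z) hd
    simp only [Matrix.mulVec_mulVec, Matrix.mulVec_smul, Matrix.mul_assoc, Units.inv_mul_cancel_left] at e1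
    rw [← Matrix.mulVec_mulVec] at e1
    exact e1
  funext s
  have e2 := congrFun h1 ((finSumFinEquiv : Fin 2 ⊕ Fin 2 ≃ Fin (2 + 2)) s)
  rw [Matrix.reindex_apply, Matrix.submatrix_mulVec_equiv, Function.comp_apply, Equiv.symm_symm,
    Equiv.symm_apply_apply, Pi.smul_apply] at e2
  rw [e2, Pi.smul_apply, hudef, Function.comp_apply]

end Residual

/-! ### Integral step: primitive rescaling of a stable line -/

section Integral

variable {p : ℕ} [Fact p.Prime]

/-- **Primitive rescaling of a stable line.**  If a non-zero `v ∈ ℚ̄_pⁿ` is a common eigenvector of integral matrices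
`M g ∈ Mₙ(ℤ̄_p)`, then dividing by a coordinate of maximal norm gives an INTEGRAL common eigenvector `w` with some
coordinate equal to `1`, and the eigenvalues are integral: `M g • w = c_g w` over `ℤ̄_p`. [folklore] -/
theorem exists_integral_eigenvector {n : ℕ} {Γ : Type*}
    (M : Γ → Matrix (Fin n) (Fin n) (Valued.integer (PadicAlgCl p)))
    (v : Fin n → PadicAlgCl p) (hv : v ≠ 0)
    (hM : ∀ g, ∃ c : PadicAlgCl p, (M g).map (Valued.integer (PadicAlgCl p)).subtype *ᵥ v = c • v) :
    ∃ (w : Fin n → Valued.integer (PadicAlgCl p)) (i : Fin n), w i = 1 ∧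
      ∀ g, ∃ c : Valued.integer (PadicAlgCl p), M g *ᵥ w = c • w := by
  -- a coordinate of maximal norm
  have hne : (Finset.univ : Finset (Fin n)).Nonempty := by
    by_contra h0
    rw [Finset.not_nonempty_iff_eq_empty, Finset.univ_eq_empty_iff] at h0
    exact hv (funext fun j => (h0.false j).elim)
  obtain ⟨i, -, hmax⟩ := Finset.exists_max_image (Finset.univ : Finset (Fin n)) (fun j => ‖v j‖) hne
  have hle : ∀ j, ‖v j‖ ≤ ‖v i‖ := fun j => hmax j (Finset.mem_univ _)
  have hq0 : v i ≠ 0 := by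
    intro h0
    apply hv
    funext j
    have h := hle j
    rw [h0, norm_zero] at h
    exact norm_le_zero_iff.mp h
  have hmem : ∀ j, v j / v i ∈ Valued.integer (PadicAlgCl p) := fun j => by
    rw [mem_integer_iff_norm_le_one, norm_div]
    exact div_le_one_of_le₀ (hle j) (norm_nonneg _)
  set w : Fin n → Valued.integer (PadicAlgCl p) := fun j => ⟨v j / v i, hmem j⟩ with hwdef
  have hwi : w i = 1 := Subtype.ext (div_self hq0)
  refine ⟨w, i, hwi, fun g => ?_⟩
  obtain ⟨c, hc⟩ := hM g
  -- over `ℚ̄_p`: `M g • w = c w`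
  have hsw : (⇑(Valued.integer (PadicAlgCl p)).subtype ∘ w) = (v i)⁻¹ • v := by
    funext j
    rw [Function.comp_apply, Subring.subtype_apply, Pi.smul_apply, smul_eq_mul, hwdef]
    exact div_eq_inv_mul (v j) (v i)
  have hw : ∀ j, (((M g *ᵥ w) j : Valued.integer (PadicAlgCl p)) : PadicAlgCl p) = c * (w j : PadicAlgCl p) := by
    intro j
    have e1 := RingHom.map_mulVec (Valued.integer (PadicAlgCl p)).subtype (M g) w j
    rw [hsw, Matrix.mulVec_smul, hc, smul_smul, Subring.subtype_apply] at e1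
    rw [e1, Pi.smul_apply, smul_eq_mul, mul_comm _ c, mul_assoc, ← div_eq_inv_mul]
  -- the eigenvalue is the `i`-th coordinate, an element of `ℤ̄_p`
  have hi : (((M g *ᵥ w) i : Valued.integer (PadicAlgCl p)) : PadicAlgCl p) = c := by
    rw [hw i, hwi, OneMemClass.coe_one, mul_one]
  refine ⟨(M g *ᵥ w) i, funext fun j => Subtype.ext ?_⟩
  rw [Pi.smul_apply, smul_eq_mul, Subring.coe_mul, hi, hw j]

end Integral

/-! ### Registered form -/

section Registered

/-- **Registered sub-goal `stub_noStableLine`** (T2, crux stmt-Langlands-13639, line `sector-klingen-split`, skeleton rev 7):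
a realiser of a NON-trivial class has no stable LINE — a primitive integral generator would reduce to a common eigenvector
of the non-split `h (σ, B; 0, σ') h⁻¹`, excluded by the invariant-subspace trichotomy (p152467).  No hypothesis on `rint`
beyond the reduction identity. [folklore] -/
theorem stub_noStableLine :
    ∀ (p : ℕ) [Fact p.Prime] (k : Type) [Field k] (Γ : Type) [Group Γ]
      (red : Valued.integer (PadicAlgCl p) →+* k) (σ σ' : Γ →* GL (Fin 2) k),
      Representation.IsIrreducible ((glStdRepresentation (Fin 2) k).comp σ) →
      Representation.IsIrreducible ((glStdRepresentation (Fin 2) k).comp σ') →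
      ∀ (B : Γ → Matrix (Fin 2) (Fin 2) k),
      (¬ ∃ X : Matrix (Fin 2) (Fin 2) k, ∀ g, B g = (σ g).val * X - X * (σ' g).val) →
      ∀ (rint : Γ → GL (Fin 4) (Valued.integer (PadicAlgCl p))) (h : GL (Fin 4) k),
      (∀ g, (Matrix.GeneralLinearGroup.map red (rint g)).val =
          h.val * Matrix.reindex finSumFinEquiv finSumFinEquiv
            (Matrix.fromBlocks (σ g).val (B g) 0 (σ' g).val) * (h⁻¹).val) →
      ¬ ∃ v : Fin 4 → PadicAlgCl p, v ≠ 0 ∧ ∀ g, ∃ c : PadicAlgCl p,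
          (Matrix.GeneralLinearGroup.map (Valued.integer (PadicAlgCl p)).subtype (rint g)).val *ᵥ v = c • v := by
  intro p _ k _ Γ _ red σ σ' hσ hσ' B hB rint h hred
  rintro ⟨v, hv0, hv⟩
  -- (1) primitive integral rescaling: an integral common eigenvector `w` with `w i = 1`
  obtain ⟨w, i, hwi, hw⟩ := exists_integral_eigenvector
    (fun g => ((rint g : GL (Fin 4) (Valued.integer (PadicAlgCl p))) :
      Matrix (Fin 4) (Fin 4) (Valued.integer (PadicAlgCl p)))) v hv0 fun g => hv g
  -- (2) reduce through `red`
  set x : Fin 4 → k := ⇑red ∘ w with hxdef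
  have hx : x ≠ 0 := fun h0 => by
    have e := congrFun h0 i
    rw [hxdef, Function.comp_apply, hwi, map_one] at e
    exact one_ne_zero e
  refine not_exists_eigenvector_residual σ σ' hσ hσ' B hB h x hx fun g => ?_
  obtain ⟨c, hc⟩ := hw g
  refine ⟨red c, ?_⟩
  rw [← hred g]
  funext j
  have e1 := RingHom.map_mulVec red
    ((rint g : GL (Fin 4) (Valued.integer (PadicAlgCl p))) : Matrix (Fin 4) (Fin 4) (Valued.integer (PadicAlgCl p))) w j
  rw [hc, Pi.smul_apply, smul_eq_mul, map_mul] at e1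
  rw [Pi.smul_apply, smul_eq_mul, hxdef, Function.comp_apply, e1]
  rfl

end Registered

end Summit.Langlands.Langlands.Cruxes.ResiduallyYoshidaLifting.SectorKlingenSplit.Fibre

end
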